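import Literature.Geometry.Riemannian.MeanConvexRadialHessian
import Literature.Geometry.Riemannian.MeanConvexSecondChainRule

/-!
# The Hessian of `x ↦ ‖Y x‖` for a `C²` map `Y`

Topic `Geometry/Riemannian` (fact seat
`provefact-Literature.Geometry.Riemannian.LawsonMichelsohn1984_surrounding`).  Everything here
is **proved**; no definitions.

In the curved setting of the surrounding construction the distance to the core disc is replaced
by `r = ‖Y‖` for a submersion `Y` onto the normal directions; the Hessians of the defining
functions `Φ(‖Y‖, t)` then involve `D²‖Y‖`, computed here from the radial Hessian
(`MeanConvexRadialHessian.lean`) and the second-order chain rule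
(`MeanConvexSecondChainRule.lean`): at a point with `y = Y x ≠ 0`, `r = ‖y‖`, `ŷ = r⁻¹ y`,

* `fderiv_norm_comp_apply` — `d‖Y‖(x) v = ⟨ŷ, DY(x) v⟩`;
* `fderiv_fderiv_norm_comp_apply` —
  `D²‖Y‖(x)(v, w) = (⟨DY v, DY w⟩ - ⟨ŷ, DY v⟩⟨ŷ, DY w⟩)/r + ⟨ŷ, D²Y(x)(v, w)⟩`
  (the flat term `(|DY v|² - ⟨ŷ, DY v⟩²)/r ≥ 0` plus the curvature term of `Y`).

## References

* H. B. Lawson, Jr., M.-L. Michelsohn, *Embedding and surrounding with positive mean curvature*,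
  Invent. Math. 77 (1984), §3. [LawsonMichelsohn1984]
-/

noncomputable section

open Set Function Filter
open scoped Topology RealInnerProductSpace

namespace Literature.Geometry.Riemannian

variable {E F : Type*} [NormedAddCommGroup E] [NormedSpace ℝ E] [NormedAddCommGroup F]
  [InnerProductSpace ℝ F] {Y : E → F} {x : E}

/-- The radial Hessian of the norm itself: `D²‖·‖(y)(u, w) = (⟨u, w⟩ - ⟨ŷ, u⟩⟨ŷ, w⟩)/‖y‖`.
[folklore] -/
theorem fderiv_fderiv_norm_apply {y : F} (hy : y ≠ 0) (u w : F) :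
    fderiv ℝ (fun z : F => fderiv ℝ (fun v : F => ‖v‖) z) y u w =
      (⟪u, w⟫ - ⟪‖y‖⁻¹ • y, u⟫ * ⟪‖y‖⁻¹ • y, w⟫) / ‖y‖ := by
  have h := fderiv_fderiv_radial_apply (g := fun s : ℝ => s) hy
    (Eventually.of_forall fun s => differentiableAt_id) (by
      rw [show deriv (fun s : ℝ => s) = fun _ => (1 : ℝ) from funext fun s => deriv_id s]
      exact differentiableAt_const _) u w
  have hid : (fun v : F => (fun s : ℝ => s) ‖v‖) = fun v => ‖v‖ := rfl
  rw [hid] at h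
  rw [h, show deriv (fun s : ℝ => s) = fun _ => (1 : ℝ) from funext fun s => deriv_id s]
  simp only [deriv_const']
  have hr : ‖y‖ ≠ 0 := norm_ne_zero_iff.2 hy
  field_simp
  ring

/-- **The differential of `‖Y‖`**: `d‖Y‖(x) v = ⟨ŷ, DY(x) v⟩` at a point with `Y x ≠ 0`, `Y`
differentiable at `x`. [folklore] -/
theorem fderiv_norm_comp_apply (hY : DifferentiableAt ℝ Y x) (hx : Y x ≠ 0) (v : E) :
    fderiv ℝ (fun z => ‖Y z‖) x v = ⟪‖Y x‖⁻¹ • Y x, fderiv ℝ Y x v⟫ := by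
  have h : HasFDerivAt (fun z => ‖Y z‖) ((innerSL ℝ (‖Y x‖⁻¹ • Y x)).comp (fderiv ℝ Y x)) x :=
    (Literature.Analysis.Potential.HyperbolicBall.hasFDerivAt_norm_of_ne_zero hx).comp x
      hY.hasFDerivAt
  rw [h.fderiv]
  simp [real_inner_smul_left]

/-- **The Hessian of `‖Y‖`** for `Y` of class `C²` at `x` with `y = Y x ≠ 0`:
`D²‖Y‖(x)(v, w) = (⟨DY v, DY w⟩ - ⟨ŷ, DY v⟩ ⟨ŷ, DY w⟩)/‖y‖ + ⟨ŷ, D²Y(x)(v, w)⟩`. [folklore] -/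
theorem fderiv_fderiv_norm_comp_apply (hY : ContDiffAt ℝ 2 Y x) (hx : Y x ≠ 0) (v w : E) :
    fderiv ℝ (fun z => fderiv ℝ (fun z => ‖Y z‖) z) x v w =
      (⟪fderiv ℝ Y x v, fderiv ℝ Y x w⟫ -
          ⟪‖Y x‖⁻¹ • Y x, fderiv ℝ Y x v⟫ * ⟪‖Y x‖⁻¹ • Y x, fderiv ℝ Y x w⟫) / ‖Y x‖ +
        ⟪‖Y x‖⁻¹ • Y x, fderiv ℝ (fderiv ℝ Y) x v w⟫ := by
  have hnorm : ContDiffAt ℝ 2 (fun v : F => ‖v‖) (Y x) := contDiffAt_norm ℝ hx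
  have h := fderiv_fderiv_comp_apply_two (Φ := fun v : F => ‖v‖) hY hnorm v w
  have hcomp : ((fun v : F => ‖v‖) ∘ Y) = fun z => ‖Y z‖ := rfl
  rw [hcomp] at h
  rw [h, fderiv_fderiv_norm_apply hx,
    (Literature.Analysis.Potential.HyperbolicBall.hasFDerivAt_norm_of_ne_zero hx).fderiv]
  simp [real_inner_smul_left]

end Literature.Geometry.Riemannian

end
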